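import Summits.ResolutionOfSingularities.ResolutionOfSingularities.Theorems.FactorContactKernels
import Summits.ResolutionOfSingularities.ResolutionOfSingularities.Theorems.MaxContactCutWeightDescent
import HarnessLib

/-!
# MaxContactCutFactorContact — decomp-res node «FactorContact» (lens-4 g17; CRITIC-LEDGER row 114 CLEARED:
DECIDED-MOD-PORT +1 cell)
refining the MaxContactCut aside 32260 (host of the lens-4 column).  Tree file 3/3 of the node.

Content VERBATIM from the decomp-res lens-4 cumulative file `HOME/decomp-res-lens-4/g18/CouplingCut.lean` (sha256
5bf7b2ca8f7311e8;
its §1–§6 = g14 HugValuationCut, ALREADY in the tree as `Theorems/HugValuationCut{Chains,Classes,Kernels}` +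
`MaxContactCutHugValuationCut`; §7–§12 = g15 «MarkingBudget» @369c12ac; §13–§17 = g16 «WeightDescent»
@1cb1c32f; §18–§23 = g17
«FactorContact» @daf245ab; §24–§31 = g18 «CouplingCut»).  HOME = run/shared/lean/pub/decomp-res.

Inside the Theses cone: §22 BY NAME — `MaxContactCut.ForcedTowersTerminate n` / 30253 / 32260 / 32203 / 31570
from the g17 residual
(L,P,drift,wild) and the lower cells modulo the COSTUME ports (`forcedTowersTerminate_of_g17`, `noForcedTowers_of_g17`, EXACT
`noForcedTowers_iff_g17`, `noSingularSurfaceHuggingTowers_iff_g17`), necessity port-free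
(`noWildDriftingTowers_of_item`); §23 the
shallow/deep form (`noSingularSurfaceHuggingTowers_iff_g17'`).

[WRITER NOTE (decomp-res writer g6): the whole lens-4 chain lives in ONE namespace `…Theorems.HugValuationCut` (the tree's g14
namespace) so that the lens's `HugChain.`/`HugShadow.`/`MarkedShadow.` dot-notation extends the landed structures
verbatim; the lens's
`noTower_iff_perfect_and_imperfect` is the tree's `ContactShadowKernels.noTower_iff_columns`; `set_option` lines
dropped; cone-free
(no `Theses` import) so the route file can import it for asides; the BY-NAME wiring to the MaxContactCut items is in the
`MaxContactCut<Node>` companion files.]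
(Sources: CossartJannsenSaito2020 Key Thm. 6.40, Cor. 6.37, Lem. 6.35/6.36; BierstoneGrigorievMilmanWlodarczyk2011
§3 (marked ideals, Lem. 3.2.1, §3.7); CossartPiltant2019; Abhyankar1956; Cutkosky2009 §2.1; Giraud1975
(Diff-lemma); EGAIV4 §16.8.)
-/

noncomputable section

open CategoryTheory AlgebraicGeometry IsLocalRing
open Literature.AlgebraicGeometry.Resolution
open Summit.ResolutionOfSingularities.ResolutionOfSingularities.Theses
open Summit.ResolutionOfSingularities.ResolutionOfSingularities.Theorems
open WeakOrderReduction ForcedTowerClasses DivergentTowerClasses MonomialTowerClasses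
open HugDimensionClasses HugDimensionKernels SurfaceShadowClasses SurfaceShadowKernels
open ContactShadowClasses (NoTowerImperfect)
open ContactShadowKernels (noTowerImperfect_of_noTower noTowerImperfect_mono noTower_iff_columns)
open NearPointCut (SingularClass singularSurface_iff_noTower)
open AbsoluteContactClasses (IsAbsContactAt)

namespace Summit.ResolutionOfSingularities.ResolutionOfSingularities.Theorems.HugValuationCut

variable {K : Type} [Field K]

/-! ## §22 (g17 · NEW) Up to the booked MaxContactCut items BY NAME — all weights -/

/-- **THE ROOT PIECE AT EVERY WEIGHT** (g16's strong induction on the weight, the drifting cell now fed by the factor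
contact port and the WILD residual). [folklore] -/
theorem forcedTowersTerminate_of_g17 (hMo : MaxContactCut.MonomialCornerAll) (hC : MaxContactCut.CurveLawAll)
    (hSL : MaxContactCut.SurfaceLawAll) (hH : MaxContactCut.NoHypersurfaceHuggingTowers) (hP : ShadowPortAll)
    (hM : MarkingPortAll) (hDesc : DescentPortAll) (hFC : FactorContactPortAll) (hO : NoOffLocusShadowTowers)
    (hNP : NoNonPrincipalInLocusTowers) (hPu : NoPurePrincipalTowers) (hW : NoWildDriftingTowers) :
    ∀ n : ℕ, 1 ≤ n → ForcedTowersTerminate n :=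
  forcedTowersTerminate_of_g16 hMo hC hSL hH hP hM hDesc hO hNP hPu (noDriftingTowers_of_g17 hFC hW)

/-- **30253 `MaxContactCut.NoForcedTowers` BY NAME.** [folklore] -/
theorem noForcedTowers_of_g17 (hMo : MaxContactCut.MonomialCornerAll) (hC : MaxContactCut.CurveLawAll)
    (hSL : MaxContactCut.SurfaceLawAll) (hH : MaxContactCut.NoHypersurfaceHuggingTowers) (hP : ShadowPortAll)
    (hM : MarkingPortAll) (hDesc : DescentPortAll) (hFC : FactorContactPortAll) (hO : NoOffLocusShadowTowers)
    (hNP : NoNonPrincipalInLocusTowers) (hPu : NoPurePrincipalTowers) (hW : NoWildDriftingTowers) :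
    MaxContactCut.NoForcedTowers :=
  forcedTowersTerminate_of_g17 hMo hC hSL hH hP hM hDesc hFC hO hNP hPu hW

/-- **THE HOST TARGET 32260 `MaxContactCut.NoSingularSurfaceHuggingTowers` BY NAME.** [folklore] -/
theorem noSingularSurfaceHuggingTowers_of_g17 (hMo : MaxContactCut.MonomialCornerAll) (hC : MaxContactCut.CurveLawAll)
    (hSL : MaxContactCut.SurfaceLawAll) (hH : MaxContactCut.NoHypersurfaceHuggingTowers) (hP : ShadowPortAll)
    (hM : MarkingPortAll) (hDesc : DescentPortAll) (hFC : FactorContactPortAll) (hO : NoOffLocusShadowTowers)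
    (hNP : NoNonPrincipalInLocusTowers) (hPu : NoPurePrincipalTowers) (hW : NoWildDriftingTowers) :
    MaxContactCut.NoSingularSurfaceHuggingTowers :=
  noSingularSurfaceHuggingTowers_of_g16 hMo hC hSL hH hP hM hDesc hO hNP hPu (noDriftingTowers_of_g17 hFC hW)

/-- **32203 `MaxContactCut.NoSurfaceHuggingTowers` BY NAME.** [folklore] -/
theorem noSurfaceHuggingTowers_of_g17 (hMo : MaxContactCut.MonomialCornerAll) (hC : MaxContactCut.CurveLawAll)
    (hSL : MaxContactCut.SurfaceLawAll) (hH : MaxContactCut.NoHypersurfaceHuggingTowers) (hP : ShadowPortAll)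
    (hM : MarkingPortAll) (hDesc : DescentPortAll) (hFC : FactorContactPortAll) (hO : NoOffLocusShadowTowers)
    (hNP : NoNonPrincipalInLocusTowers) (hPu : NoPurePrincipalTowers) (hW : NoWildDriftingTowers) :
    MaxContactCut.NoSurfaceHuggingTowers :=
  noSurfaceHuggingTowers_of_g16 hMo hC hSL hH hP hM hDesc hO hNP hPu (noDriftingTowers_of_g17 hFC hW)

/-- **31570 `MaxContactCut.NoHuggingTowers` BY NAME.** [folklore] -/
theorem noHuggingTowers_of_g17 (hMo : MaxContactCut.MonomialCornerAll) (hC : MaxContactCut.CurveLawAll)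
    (hSL : MaxContactCut.SurfaceLawAll) (hH : MaxContactCut.NoHypersurfaceHuggingTowers) (hP : ShadowPortAll)
    (hM : MarkingPortAll) (hDesc : DescentPortAll) (hFC : FactorContactPortAll) (hO : NoOffLocusShadowTowers)
    (hNP : NoNonPrincipalInLocusTowers) (hPu : NoPurePrincipalTowers) (hW : NoWildDriftingTowers) :
    MaxContactCut.NoHuggingTowers :=
  noHuggingTowers_of_g16 hMo hC hSL hH hP hM hDesc hO hNP hPu (noDriftingTowers_of_g17 hFC hW)

/-- Necessity, port-free: 32260 implies the wild residual over all weights. [folklore] -/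
theorem noWildDriftingTowers_of_item (h : MaxContactCut.NoSingularSurfaceHuggingTowers) : NoWildDriftingTowers :=
  fun n hn => wildDrifting_of_singularSurface (h n hn)

/-- Necessity, port-free: 30253 implies the wild residual over all weights. [folklore] -/
theorem noWildDriftingTowers_of_noForcedTowers (h : MaxContactCut.NoForcedTowers) : NoWildDriftingTowers :=
  fun n hn => wildDrifting_of_drifting ((residuals_of_noForcedTowers h).2.2.2 n hn)

/-- **EXACT AT THE ROOT 30253 modulo the decided pieces and the four COSTUME ports**:
`MaxContactCut.NoForcedTowers ⟺ (O) ∧ (L,¬P) ∧ (L,P,pure) ∧ (L,P,drift,WILD)` over all weights. [folklore] -/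
theorem noForcedTowers_iff_g17 (hMo : MaxContactCut.MonomialCornerAll) (hC : MaxContactCut.CurveLawAll)
    (hSL : MaxContactCut.SurfaceLawAll) (hH : MaxContactCut.NoHypersurfaceHuggingTowers) (hP : ShadowPortAll)
    (hM : MarkingPortAll) (hDesc : DescentPortAll) (hFC : FactorContactPortAll) :
    MaxContactCut.NoForcedTowers ↔
      NoOffLocusShadowTowers ∧ NoNonPrincipalInLocusTowers ∧ NoPurePrincipalTowers ∧ NoWildDriftingTowers :=
  ⟨fun h => ⟨(residuals_of_noForcedTowers h).1, (residuals_of_noForcedTowers h).2.1,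
    (residuals_of_noForcedTowers h).2.2.1, noWildDriftingTowers_of_noForcedTowers h⟩,
    fun h => noForcedTowers_of_g17 hMo hC hSL hH hP hM hDesc hFC h.1 h.2.1 h.2.2.1 h.2.2.2⟩

/-- **EXACT AT THE HOST 32260 modulo the decided pieces and the ports** (through the root induction). [folklore] -/
theorem noSingularSurfaceHuggingTowers_iff_g17 (hMo : MaxContactCut.MonomialCornerAll) (hC : MaxContactCut.CurveLawAll)
    (hSL : MaxContactCut.SurfaceLawAll) (hH : MaxContactCut.NoHypersurfaceHuggingTowers) (hP : ShadowPortAll)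
    (hM : MarkingPortAll) (hDesc : DescentPortAll) (hFC : FactorContactPortAll) :
    MaxContactCut.NoSingularSurfaceHuggingTowers ↔
      NoOffLocusShadowTowers ∧ NoNonPrincipalInLocusTowers ∧ NoPurePrincipalTowers ∧ NoWildDriftingTowers :=
  ⟨fun h => ⟨noOffLocusShadowTowers_of_item h, noNonPrincipalInLocusTowers_of_item h, noPurePrincipalTowers_of_item h,
    noWildDriftingTowers_of_item h⟩,
    fun h => noSingularSurfaceHuggingTowers_of_g17 hMo hC hSL hH hP hM hDesc hFC h.1 h.2.1 h.2.2.1 h.2.2.2⟩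

/-! ## §23 (g17 · NEW) The codimension-two cell (L,¬P) cut by the EMBEDDING DIMENSION of the hug: SHALLOW hugs are
CONTACT hugs (edge to the tree leaf 31571 BY NAME), DEEP hugs are the located codimension-two residual -/

/-- **(L,¬P) over all weights from the tree item 31571 `MaxContactCut.NoContactHuggingTowers` BY NAME, the COSTUME port
and the deep residual.** [folklore] -/
theorem noNonPrincipalInLocusTowers_of_g17 (hSh : ShallowContactPortAll) (hCo : MaxContactCut.NoContactHuggingTowers)
    (hDeep : NoDeepNonPrincipalTowers) : NoNonPrincipalInLocusTowers :=
  fun n hn => nonPrincipal_of_g17 (hSh n hn) (hCo n hn) (hDeep n hn)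

/-- Necessity, port-free: 32260 implies the deep residual over all weights. [folklore] -/
theorem noDeepNonPrincipalTowers_of_item (h : MaxContactCut.NoSingularSurfaceHuggingTowers) : NoDeepNonPrincipalTowers :=
  fun n hn => deepNonPrincipal_of_nonPrincipal (noNonPrincipalInLocusTowers_of_item h n hn)

/-- **THE HOST 32260 BY NAME from BOTH g17 cuts**: the tree's decided pieces, the tree item 31571, the five COSTUME
ports and the THREE located residuals (O), (L,¬P,deep), (L,P,drift,wild) plus the inherited pure cell. [folklore] -/
theorem noSingularSurfaceHuggingTowers_of_g17' (hMo : MaxContactCut.MonomialCornerAll) (hC : MaxContactCut.CurveLawAll)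
    (hSL : MaxContactCut.SurfaceLawAll) (hH : MaxContactCut.NoHypersurfaceHuggingTowers)
    (hCo : MaxContactCut.NoContactHuggingTowers) (hP : ShadowPortAll) (hM : MarkingPortAll) (hDesc : DescentPortAll)
    (hFC : FactorContactPortAll) (hSh : ShallowContactPortAll) (hO : NoOffLocusShadowTowers)
    (hDeep : NoDeepNonPrincipalTowers) (hPu : NoPurePrincipalTowers) (hW : NoWildDriftingTowers) :
    MaxContactCut.NoSingularSurfaceHuggingTowers :=
  noSingularSurfaceHuggingTowers_of_g17 hMo hC hSL hH hP hM hDesc hFC hO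
    (noNonPrincipalInLocusTowers_of_g17 hSh hCo hDeep) hPu hW

/-- **EXACT AT THE HOST with both cuts** (mod decided pieces, 31571 and the ports): 32260 ⟺ (O) ∧ (L,¬P,deep) ∧
(L,P,pure) ∧ (L,P,drift,wild). [folklore] -/
theorem noSingularSurfaceHuggingTowers_iff_g17' (hMo : MaxContactCut.MonomialCornerAll) (hC : MaxContactCut.CurveLawAll)
    (hSL : MaxContactCut.SurfaceLawAll) (hH : MaxContactCut.NoHypersurfaceHuggingTowers)
    (hCo : MaxContactCut.NoContactHuggingTowers) (hP : ShadowPortAll) (hM : MarkingPortAll) (hDesc : DescentPortAll)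
    (hFC : FactorContactPortAll) (hSh : ShallowContactPortAll) :
    MaxContactCut.NoSingularSurfaceHuggingTowers ↔
      NoOffLocusShadowTowers ∧ NoDeepNonPrincipalTowers ∧ NoPurePrincipalTowers ∧ NoWildDriftingTowers :=
  ⟨fun h => ⟨noOffLocusShadowTowers_of_item h, noDeepNonPrincipalTowers_of_item h, noPurePrincipalTowers_of_item h,
    noWildDriftingTowers_of_item h⟩,
    fun h => noSingularSurfaceHuggingTowers_of_g17' hMo hC hSL hH hCo hP hM hDesc hFC hSh h.1 h.2.1 h.2.2.1 h.2.2.2⟩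

end Summit.ResolutionOfSingularities.ResolutionOfSingularities.Theorems.HugValuationCut
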